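import Mathlib
import HarnessLib
import Summits.CriticalPhenomena.Ising3DConformalLimit.Theses.ArmDressing
import Literature.Probability.LatticeModels.RandomClusterDomainMarkov
import Literature.Barriers.CriticalPhenomena.RandomClusterFirstOrderProofs
import Literature.Probability.LatticeModels.CriticalFKIsingThinnedConnectionLaws

/-!
# Box limits of the pattern events of the crux `ArmDressing.EvenPatternDecoupling`:
# the stub `stub_patternBoxLimits` (route ArmDressing, item stmt-CriticalPhenomena-16133, line `registered`)

The registered stub 5b of the skeleton `Cruxes/EvenPatternDecoupling/Lines/birth.lean`: for the wired
critical FK-Ising boxes `Λ_L ↑ ℤ³` (`q = 2`, `p = 1 - e^{-2β_c(3)}`), every mesh `δ > 0` and all data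
`n, c, r, b, s, z`, the box probabilities of the four PATTERN events converge as `L → ∞`:
(i) the parity pattern `EVEN(z^δ)` of the open-path connections among the `n` point sites `z_j^δ`;
(ii) the ball pattern with ball arms `EVEN2 ∩ CROSS` of the family (closed inner balls) ++ (outer
complements); (iii)/(iv) the crossing-cluster pattern events `Uni ∩ Patt` (connections OUTSIDE the
inner balls) intersected with the point arms, resp. the ball arms.

Proof: all four events are laws of finitely many CONNECTION QUERIES of the box configuration —
"some `x ∈ A`, `y ∈ B` of `Λ_L` are joined by an open path of `Λ_L` through vertices of `O`" with
`A`, `B` finite or co-finite lattice sets — and such laws converge along the wired critical boxes by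
`Literature.Probability.LatticeModels.tendsto_rcMeasure_real_thinConnLaw_criticalBeta`
(`CriticalFKIsingThinnedConnectionLaws.lean`; for (i)–(ii), where `O = ℤ³`, already
`tendsto_rcMeasure_real_connRelLaw_criticalBeta` of `CriticalFKIsingConnectionLaws.lean`): ghost-wired
connection events are antitone in the box (Grimmett 2006, Lemma (4.13) and eq. (4.24)), the wiring
correction is a finite union of one-arm events of fixed lattice points, which vanish at `β_c(3)`
because `φ¹_{Λ_L}(0 ↔ ∂Λ_L) = ⟨σ_0⟩⁺_{Λ_{L-1};β_c} → m*(β_c) = 0` (Edwards–Sokal with wired/plus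
boundary; Aizenman–Duminil-Copin–Sidoravicius 2015), and laws follow from events by finite
additivity. For (iii)/(iv) the queries are: the arms `K_j ↔ (B(c_j,r_j)ᶜ)^δ` (through `ℤ³`), and,
through the set `O` of lattice sites outside all closed inner balls, `x ↔ O ∖ B(c_j,r_j)^δ` and
`x ↔ x'` for `x, x'` in the finite set `X` of lattice neighbours of the inner balls (the only possible
crossing rim sites); for `L` so large that `Λ_L` contains `X` and the inner balls, `Uni ∩ Patt ∩ arms`
is literally the event that the answers lie in a fixed set of answer functions.

References: G. Grimmett, *The Random-Cluster Model* (2006), Lemma (4.13), Thm. (4.19);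
M. Aizenman, H. Duminil-Copin, V. Sidoravicius, Comm. Math. Phys. 334 (2015), Thm. 1.2.
No definitions, no named facts.
-/

namespace Summit.CriticalPhenomena.Ising3DConformalLimit.Theorems.EvenPatternDecoupling

open MeasureTheory Finset SimpleGraph Filter Topology
open Literature.Probability.LatticeModels Literature.Probability.Percolation
open Literature.Barriers.CriticalPhenomena

/-! ### Lattice sets cut out by the mesh embedding; the plain connection laws -/

/-- For `δ > 0` only finitely many lattice points are mapped by the mesh embedding `x ↦ δ x` into
a bounded set of `ℝ³` (they lie in the box of radius `⌈ρ/δ⌉`). [folklore] -/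
theorem finite_mesh_mem {δ : ℝ} (hδ : 0 < δ) {A : Set (EuclideanSpace ℝ (Fin 3))}
    (hA : Bornology.IsBounded A) :
    {v : Site 3 | (WithLp.toLp 2 fun i : Fin 3 => δ * (v i : ℝ) : EuclideanSpace ℝ (Fin 3)) ∈ A}.Finite := by
  obtain ⟨ρ, hρ⟩ := hA.subset_closedBall 0
  refine (box 3 ⌈ρ / δ⌉₊).finite_toSet.subset fun v hv => ?_
  have hvρ : ‖(WithLp.toLp 2 fun i : Fin 3 => δ * (v i : ℝ) : EuclideanSpace ℝ (Fin 3))‖ ≤ ρ := by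
    have := hρ hv
    rwa [Metric.mem_closedBall, dist_zero_right] at this
  rw [Finset.mem_coe, mem_box]
  intro i
  have h1 : |δ * (v i : ℝ)| ≤ ρ := by
    have h := PiLp.norm_apply_le (WithLp.toLp 2 fun i : Fin 3 => δ * (v i : ℝ) : EuclideanSpace ℝ (Fin 3)) i
    rw [Real.norm_eq_abs] at h
    exact h.trans hvρ
  rw [abs_mul, abs_of_pos hδ] at h1
  have h2 : |(v i : ℝ)| ≤ ρ / δ := by
    rw [le_div_iff₀ hδ, mul_comm]; exact h1
  have h3 : |(v i : ℝ)| ≤ (⌈ρ / δ⌉₊ : ℝ) := h2.trans (Nat.le_ceil _)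
  have h4 : |v i| ≤ (⌈ρ / δ⌉₊ : ℤ) := by
    have : ((|v i| : ℤ) : ℝ) ≤ ((⌈ρ / δ⌉₊ : ℤ) : ℝ) := by push_cast; exact h3
    exact_mod_cast this
  exact abs_le.1 h4

/-- The law of the connection relation depends on the piece only through its value (transport along
`box 3 L = Λ_L + 0`). [folklore] -/
theorem relLaw_congr_dom {S S' : Finset (Site 3)} (h : S = S') (p q : ℝ) {m : ℕ}
    (K : Fin m → Set (Site 3)) (R : Set (Fin m → Fin m → Prop)) :
    (rcMeasure (finsetGraph (zdGraph 3) S) p q (wiredBoundary (zdGraph 3) S)).real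
        {ω | (fun i j => ∃ x y : ↥S, x.1 ∈ K i ∧ y.1 ∈ K j ∧ (openGraph ω).Reachable x y) ∈ R} =
      (rcMeasure (finsetGraph (zdGraph 3) S') p q (wiredBoundary (zdGraph 3) S')).real
        {ω | (fun i j => ∃ x y : ↥S', x.1 ∈ K i ∧ y.1 ∈ K j ∧ (openGraph ω).Reachable x y) ∈ R} := by
  subst h
  rfl

/-- **(i)/(ii): the wired critical box probabilities of a connection-relation event converge** for
probes each finite or co-finite (`tendsto_rcMeasure_real_connRelLaw_criticalBeta` at `v = 0`,
transported to `box 3 L`). [cite: Grimmett2006, Thm. (4.19), proof] -/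
theorem tendsto_measureReal_relLaw {m : ℕ} (K : Fin m → Set (Site 3))
    (hK : ∀ i, (K i).Finite ∨ (K i)ᶜ.Finite) (R : Set (Fin m → Fin m → Prop)) :
    ∃ a : ℝ, Tendsto (fun L => (rcMeasure (boxGraph 3 L) (fkIsingParam (criticalBeta 3)) 2
      (boxBoundary 3 L)).real {ω | (fun i j => ∃ x y : BoxV 3 L, x.1 ∈ K i ∧ y.1 ∈ K j ∧
        (openGraph ω).Reachable x y) ∈ R}) atTop (𝓝 a) := by
  obtain ⟨ℓ, hℓ⟩ := tendsto_rcMeasure_real_connRelLaw_criticalBeta (d := 3) le_rfl hK R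
  exact ⟨ℓ, (hℓ 0).congr fun L => (relLaw_congr_dom (box_eq_icc_shift_zero L) _ _ K R).symm⟩

/-! ### The stub -/

-- the registered stub signature is the crux's full `let` preamble, several binders of which
-- (`Pr`, `Supp`, …) are not used by this clause (linter.unusedVariables would flag the verbatim statement)
set_option linter.unusedVariables false in
/-- stub 5b of `Cruxes/EvenPatternDecoupling/Lines/birth.lean` (line `registered`), PROVED: **the
wired critical FK-Ising box probabilities of the four PATTERN events converge as `L → ∞`** — for
every mesh `δ > 0` and all data: (i) the parity pattern `EVEN(z^δ)` of the point sites, (ii) the ball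
pattern with ball arms `EVEN2 ∩ CROSS`, (iii)/(iv) the crossing-cluster pattern events `Uni ∩ Patt`
(connectivity outside the inner balls) intersected with the point arms, resp. the ball arms. All
four are laws of finitely many (thinned) connection queries with finite or co-finite probes, which
converge along the wired critical boxes of `ℤ³` (ghost-wired events antitone in the box, one-arm
correction `→ m*(β_c(3)) = 0`, finite additivity): `tendsto_rcMeasure_real_connRelLaw_criticalBeta`,
`tendsto_rcMeasure_real_thinConnLaw_criticalBeta`. [cite: Grimmett2006, Thm. (4.19), proof] -/
theorem stub_patternBoxLimits : open Literature.Probability.LatticeModels Literature.Probability.Percolation Literature.Barriers.CriticalPhenomena Filter Topology in let E3 := EuclideanSpace ℝ (Fin 3); let μ : (L : ℕ) → MeasureTheory.Measure (BondConfig (BoxV 3 L)) := fun L => rcMeasure (boxGraph 3 L) (fkIsingParam (criticalBeta 3)) 2 (boxBoundary 3 L); let PrL : (m : ℕ) → (Fin m → Set (Site 3)) → Set (Fin m → Fin m → Prop) → ℕ → ℝ := fun _ K R L => (μ L).real {ω | (fun i j => ∃ x y : BoxV 3 L, x.1 ∈ K i ∧ y.1 ∈ K j ∧ (openGraph ω).Reachable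 x y) ∈ R}; let Pr : (m : ℕ) → (Fin m → Set (Site 3)) → Set (Fin m → Fin m → Prop) → ℝ := fun m K R => limUnder atTop (PrL m K R); let mesh : ℝ → Site 3 → E3 := fun δ z => WithLp.toLp 2 fun i : Fin 3 => δ * (z i : ℝ); let disc : ℝ → Set E3 → Set (Site 3) := fun δ A => {x | mesh δ x ∈ A}; let EVEN : (n : ℕ) → Set (Fin n → Fin n → Prop) := fun n => {R | ∀ i, Even ({j : Fin n | R i j}.ncard)}; let EVEN2 : (n : ℕ) → Set (Fin (n + n) → Fin (n + n) → Prop) := fun n => {R | ∀ i : Fin n, Even ({j : Fin n | R (Fin.castAdd n i) (Fin.castAdd n j)}.ncard)}; let CROSS : (n : ℕ) → Set (Fin (n + n) → Fin (n + n) → Prop) := fun n => {R | ∀ i : Fin n, R (Fin.castAdd n i) (Fin.natAdd n i)}; let pts : (n : ℕ) → ℝ → (Fin n → E3) → (Fin n → Set (Site 3)) := fun _ δ z j => {latticeApprox δ (z j)}; let fam : (n : ℕ) → ℝ → (Fin n → Set E3) → (Fin n → Set E3) → (Fin (n + n) → Set (Site 3)) := fun _ δ A B => Fin.append (fun j =>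 disc δ (A j)) (fun j => disc δ (B j)); let Supp : (L : ℕ) → Set (BondConfig (BoxV 3 L)) := fun L => {ω | ω ⊆ (boxGraph 3 L).edgeSet}; let Ev : (m : ℕ) → (Fin m → Set (Site 3)) → Set (Fin m → Fin m → Prop) → (L : ℕ) → Set (BondConfig (BoxV 3 L)) := fun _ K R L => {ω | (fun i j => ∃ x y : BoxV 3 L, x.1 ∈ K i ∧ y.1 ∈ K j ∧ (openGraph ω).Reachable x y) ∈ R}; let Out : (n : ℕ) → ℝ → (Fin n → E3) → (Fin n → ℝ) → (L : ℕ) → Set (BoxV 3 L) := fun _ δ b s L => {x | ∀ k, mesh δ x.1 ∉ Metric.closedBall (b k) (s k)}; let RO : (L : ℕ) → BondConfig (BoxV 3 L) → Set (BoxV 3 L) → BoxV 3 L → BoxV 3 L → Prop := fun L ω O x y => (SimpleGraph.fromRel fun a a' : BoxV 3 L => s(a, a') ∈ ω ∧ a ∈ O ∧ a' ∈ O).Reachable x y; let Crs : (n : ℕ) → ℝ → (Fin n → E3) → (Fin n → ℝ) → (Fin n → E3) → (Fin n → ℝ) → (L : ℕ) → BondConfig (BoxV 3 L) → Fin n → BoxV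 3 L → Prop := fun n δ c r b s L ω j x => x ∈ Out n δ b s L ∧ (∃ y : BoxV 3 L, mesh δ y.1 ∈ Metric.closedBall (b j) (s j) ∧ (boxGraph 3 L).Adj x y) ∧ (∃ y : BoxV 3 L, y ∈ Out n δ b s L ∧ mesh δ y.1 ∈ (Metric.ball (c j) (r j))ᶜ ∧ RO L ω (Out n δ b s L) x y); let Uni : (n : ℕ) → ℝ → (Fin n → E3) → (Fin n → ℝ) → (Fin n → E3) → (Fin n → ℝ) → (L : ℕ) → Set (BondConfig (BoxV 3 L)) := fun n δ c r b s L => {ω | ∀ (j : Fin n) (x x' : BoxV 3 L), Crs n δ c r b s L ω j x → Crs n δ c r b s L ω j x' → RO L ω (Out n δ b s L) x x'}; let Patt : (n : ℕ) → ℝ → (Fin n → E3) → (Fin n → ℝ) → (Fin n → E3) → (Fin n → ℝ) → (L : ℕ) → Set (BondConfig (BoxV 3 L)) := fun n δ c r b s L => {ω | (fun i j => ∃ x x' : BoxV 3 L, Crs n δ c r b s L ω i x ∧ Crs n δ c r b s L ω j x' ∧ RO L ω (Out n δ b s L) x x') ∈ EVEN n}; ∀ (n : ℕ) (c : Fin n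 → E3) (r : Fin n → ℝ) (b : Fin n → E3) (s : Fin n → ℝ) (z : Fin n → E3) (δ : ℝ), 0 < δ → (∃ a : ℝ, Tendsto (PrL n (pts n δ z) (EVEN n)) atTop (𝓝 a)) ∧ (∃ a : ℝ, Tendsto (PrL (n + n) (fam n δ (fun j => Metric.closedBall (b j) (s j)) (fun j => (Metric.ball (c j) (r j))ᶜ)) (EVEN2 n ∩ CROSS n)) atTop (𝓝 a)) ∧ (∃ a : ℝ, Tendsto (fun L => (μ L).real (Uni n δ c r b s L ∩ Patt n δ c r b s L ∩ Ev (n + n) (Fin.append (pts n δ z) (fun j => disc δ (Metric.ball (c j) (r j))ᶜ)) (CROSS n) L)) atTop (𝓝 a)) ∧ (∃ a : ℝ, Tendsto (fun L => (μ L).real (Uni n δ c r b s L ∩ Patt n δ c r b s L ∩ Ev (n + n) (fam n δ (fun j => Metric.closedBall (b j) (s j)) (fun j => (Metric.ball (c j) (r j))ᶜ)) (CROSS n) L)) atTop (𝓝 a)) := by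
  intro E3 μ PrL Pr mesh disc EVEN EVEN2 CROSS pts fam Supp Ev Out RO Crs Uni Patt n c r b s z δ hδ
  -- the lattice points of closed balls are finite sets; those outside open balls are co-finite sets
  have hballfin : ∀ (b' : E3) (s' : ℝ), (disc δ (Metric.closedBall b' s')).Finite := fun b' s' =>
    finite_mesh_mem hδ Metric.isBounded_closedBall
  have hcofin : ∀ (c' : E3) (r' : ℝ), (disc δ (Metric.ball c' r')ᶜ)ᶜ.Finite := fun c' r' => by
    have h : (disc δ (Metric.ball c' r')ᶜ)ᶜ = disc δ (Metric.ball c' r') := by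
      ext v; simp only [disc, Set.mem_compl_iff, Set.mem_setOf_eq, not_not]
    rw [h]
    exact finite_mesh_mem hδ Metric.isBounded_ball
  refine ⟨tendsto_measureReal_relLaw (pts n δ z) (fun j => Or.inl (Set.finite_singleton _)) (EVEN n),
    ?_, ?_⟩
  · -- (ii): inner balls finite, outer complements co-finite
    refine tendsto_measureReal_relLaw (fam n δ (fun j => Metric.closedBall (b j) (s j))
      (fun j => (Metric.ball (c j) (r j))ᶜ)) (fun i => ?_) (EVEN2 n ∩ CROSS n)
    induction i using Fin.addCases with
    | left j =>
      left
      show (Fin.append _ _ (Fin.castAdd n j) : Set (Site 3)).Finite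
      rw [Fin.append_left]
      exact hballfin (b j) (s j)
    | right j =>
      right
      show (Fin.append _ _ (Fin.natAdd n j) : Set (Site 3))ᶜ.Finite
      rw [Fin.append_right]
      exact hcofin (c j) (r j)
  -- (iii)/(iv): `Uni ∩ Patt ∩ arms` for inner arm probes `Kin j` that are finite sets
  suffices main : ∀ Kin : Fin n → Set (Site 3), (∀ j, (Kin j).Finite) →
      ∃ a : ℝ, Tendsto (fun L => (μ L).real (Uni n δ c r b s L ∩ Patt n δ c r b s L ∩
        Ev (n + n) (Fin.append Kin (fun j => disc δ (Metric.ball (c j) (r j))ᶜ)) (CROSS n) L))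
        atTop (𝓝 a) from
    ⟨main (pts n δ z) fun j => Set.finite_singleton _, main _ fun j => hballfin (b j) (s j)⟩
  intro Kin hKin
  -- the lattice sites outside the closed inner balls (co-finite) and the possible rim sites (finite)
  set O : Set (Site 3) := {v | ∀ k, mesh δ v ∉ Metric.closedBall (b k) (s k)} with hO
  have hOfin : Oᶜ.Finite := by
    refine (Set.finite_iUnion fun k => hballfin (b k) (s k)).subset fun v hv => ?_
    simp only [hO, Set.mem_compl_iff, Set.mem_setOf_eq, not_forall, not_not] at hv
    exact Set.mem_iUnion.2 hv
  have hRimfin : {v : Site 3 | ∃ (j : Fin n) (w : Site 3),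
      w ∈ disc δ (Metric.closedBall (b j) (s j)) ∧ (zdGraph 3).Adj v w}.Finite := by
    refine (Set.finite_iUnion fun j : Fin n => (hballfin (b j) (s j)).biUnion fun w _ =>
      ((zdGraph 3).neighborSet w).toFinite).subset ?_
    rintro v ⟨j, w, hw, hvw⟩
    exact Set.mem_iUnion.2 ⟨j, Set.mem_iUnion₂.2 ⟨w, hw, hvw.symm⟩⟩
  set X : Finset (Site 3) := hRimfin.toFinset with hXdef
  have hX : ∀ (v : Site 3) (j : Fin n) (w : Site 3), w ∈ disc δ (Metric.closedBall (b j) (s j)) →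
      (zdGraph 3).Adj v w → v ∈ X := fun v j w hw hvw => hRimfin.mem_toFinset.2 ⟨j, w, hw, hvw⟩
  -- the queries, indexed by `Fin n ⊕ ((X × Fin n) ⊕ (X × X))`: the arms `Kin j ↔ (B(c_j,r_j)ᶜ)^δ`
  -- (through `ℤ³`); through `O`: `x ↔ O ∖ B(c_j,r_j)^δ` and `x ↔ x'` for rim sites `x, x'`
  set qA : Fin n ⊕ ((↥X × Fin n) ⊕ (↥X × ↥X)) → Set (Site 3) :=
    Sum.elim (fun j => Kin j) (Sum.elim (fun p => {p.1.1}) (fun p => {p.1.1})) with hqA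
  set qB : Fin n ⊕ ((↥X × Fin n) ⊕ (↥X × ↥X)) → Set (Site 3) :=
    Sum.elim (fun j => disc δ (Metric.ball (c j) (r j))ᶜ)
      (Sum.elim (fun p => O ∩ disc δ (Metric.ball (c p.2) (r p.2))ᶜ) (fun p => {p.2.1})) with hqB
  set qO : Fin n ⊕ ((↥X × Fin n) ⊕ (↥X × ↥X)) → Set (Site 3) :=
    Sum.elim (fun _ => Set.univ) (fun _ => O) with hqO
  -- the crossing sites of annulus `j` among `X`, read from the answers `ρ` to the queries
  set CrsQ : (Fin n ⊕ ((↥X × Fin n) ⊕ (↥X × ↥X)) → Prop) → Fin n → ↥X → Prop := fun ρ j x =>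
    x.1 ∈ O ∧ (∃ w : Site 3, w ∈ disc δ (Metric.closedBall (b j) (s j)) ∧ (zdGraph 3).Adj x.1 w) ∧
      ρ (Sum.inr (Sum.inl (x, j))) with hCrsQ
  -- the answer functions for which `Uni ∩ Patt ∩ arms` holds
  set qR : Set (Fin n ⊕ ((↥X × Fin n) ⊕ (↥X × ↥X)) → Prop) :=
    {ρ | (∀ (j : Fin n) (x x' : ↥X), CrsQ ρ j x → CrsQ ρ j x' → ρ (Sum.inr (Sum.inr (x, x')))) ∧
      (fun i j => ∃ x x' : ↥X, CrsQ ρ i x ∧ CrsQ ρ j x' ∧ ρ (Sum.inr (Sum.inr (x, x')))) ∈ EVEN n ∧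
      ∀ j : Fin n, ρ (Sum.inl j)} with hqR
  have hA : ∀ q, (qA q).Finite ∨ (qA q)ᶜ.Finite := by
    rintro (j | (p | p))
    · exact Or.inl (hKin j)
    · exact Or.inl (Set.finite_singleton _)
    · exact Or.inl (Set.finite_singleton _)
  have hB : ∀ q, (qB q).Finite ∨ (qB q)ᶜ.Finite := by
    rintro (j | (p | p))
    · exact Or.inr (hcofin (c j) (r j))
    · right
      show (O ∩ disc δ (Metric.ball (c p.2) (r p.2))ᶜ)ᶜ.Finite
      rw [Set.compl_inter]
      exact hOfin.union (hcofin (c p.2) (r p.2))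
    · exact Or.inl (Set.finite_singleton _)
  obtain ⟨ℓ, hℓ⟩ := tendsto_rcMeasure_real_thinConnLaw_criticalBeta (d := 3) le_rfl
    (A := qA) (B := qB) qO hA hB qR
  -- eventually the box contains the rim sites and the inner balls
  obtain ⟨L₀, hL₀⟩ := exists_subset_box_of_set_finite
    (X.finite_toSet.union (Set.finite_iUnion fun j : Fin n => hballfin (b j) (s j)))
  refine ⟨ℓ, hℓ.congr' ?_⟩
  filter_upwards [eventually_ge_atTop L₀] with L hL
  have hsub := hL₀.trans (Finset.coe_subset.2 (box_mono 3 hL))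
  have hXL : ∀ v ∈ X, v ∈ box 3 L := fun v hv => Finset.mem_coe.1 (hsub (Set.mem_union_left _ hv))
  have hball : ∀ (j : Fin n) (w : Site 3), w ∈ disc δ (Metric.closedBall (b j) (s j)) → w ∈ box 3 L :=
    fun j w hw => hsub (Set.mem_union_right _ (Set.mem_iUnion.2 ⟨j, hw⟩))
  -- the two events coincide
  have key : ∀ ω : BondConfig (BoxV 3 L),
      (fun q => ∃ x y : BoxV 3 L, x.1 ∈ qA q ∧ y.1 ∈ qB q ∧
        (openGraph (ω ∩ {e : Sym2 (BoxV 3 L) | ∀ v ∈ e, v.1 ∈ qO q})).Reachable x y) ∈ qR ↔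
      ω ∈ Uni n δ c r b s L ∧ ω ∈ Patt n δ c r b s L ∧
        ω ∈ Ev (n + n) (Fin.append Kin (fun j => disc δ (Metric.ball (c j) (r j))ᶜ)) (CROSS n) L := by
    intro ω
    set ρ : Fin n ⊕ ((↥X × Fin n) ⊕ (↥X × ↥X)) → Prop := fun q => ∃ x y : BoxV 3 L, x.1 ∈ qA q ∧
      y.1 ∈ qB q ∧ (openGraph (ω ∩ {e : Sym2 (BoxV 3 L) | ∀ v ∈ e, v.1 ∈ qO q})).Reachable x y with hρ
    -- `RO` is reachability in the open graph of the configuration thinned to `O`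
    have hG : (SimpleGraph.fromRel fun a a' : BoxV 3 L =>
        s(a, a') ∈ ω ∧ a ∈ Out n δ b s L ∧ a' ∈ Out n δ b s L) =
        openGraph (ω ∩ {e : Sym2 (BoxV 3 L) | ∀ v ∈ e, v.1 ∈ O}) := by
      ext a a'
      rw [SimpleGraph.fromRel_adj, openGraph_adj, mk_mem_thin_iff, Sym2.eq_swap (a := a') (b := a)]
      simp only [Out, hO, Set.mem_setOf_eq]
      tauto
    have hRO : ∀ x y : BoxV 3 L, RO L ω (Out n δ b s L) x y ↔
        (openGraph (ω ∩ {e : Sym2 (BoxV 3 L) | ∀ v ∈ e, v.1 ∈ O})).Reachable x y := by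
      intro x y
      show (SimpleGraph.fromRel _).Reachable x y ↔ _
      rw [hG]
    -- crossing sites are rim sites, and `Crs` is read from the answers
    have hmemX : ∀ {j : Fin n} {x : BoxV 3 L}, Crs n δ c r b s L ω j x → x.1 ∈ X := by
      intro j x hx
      obtain ⟨-, ⟨y, hy, hxy⟩, -⟩ := hx
      exact hX x.1 j y.1 hy hxy
    have hcrs : ∀ (j : Fin n) (x : BoxV 3 L) (x₀ : ↥X), x₀.1 = x.1 →
        (Crs n δ c r b s L ω j x ↔ CrsQ ρ j x₀) := by
      intro j x x₀ hx
      simp only [Crs, hCrsQ, hρ, hqA, hqB, hqO, Sum.elim_inr, Sum.elim_inl, hx, Set.mem_singleton_iff,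
        Set.mem_inter_iff]
      refine and_congr Iff.rfl (and_congr ⟨?_, ?_⟩ ⟨?_, ?_⟩)
      · rintro ⟨y, hy, hxy⟩
        exact ⟨y.1, hy, hxy⟩
      · rintro ⟨w, hw, hxw⟩
        exact ⟨⟨w, hball j w hw⟩, hw, hxw⟩
      · rintro ⟨y, hyO, hy, hxy⟩
        exact ⟨x, y, rfl, ⟨hyO, hy⟩, (hRO x y).1 hxy⟩
      · rintro ⟨a, y, ha, ⟨hyO, hy⟩, hay⟩
        have hax : a = x := Subtype.ext ha
        subst hax
        exact ⟨y, hyO, hy, (hRO a y).2 hay⟩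
    -- the pair query `x ↔ x'` through `O`
    have hpair : ∀ x x' : ↥X, ρ (Sum.inr (Sum.inr (x, x'))) ↔
        (openGraph (ω ∩ {e : Sym2 (BoxV 3 L) | ∀ v ∈ e, v.1 ∈ O})).Reachable
          ⟨x.1, hXL _ x.2⟩ ⟨x'.1, hXL _ x'.2⟩ := by
      intro x x'
      simp only [hρ, hqA, hqB, hqO, Sum.elim_inr, Set.mem_singleton_iff]
      constructor
      · rintro ⟨a, y, ha, hy, hay⟩
        have h1 : a = ⟨x.1, hXL _ x.2⟩ := Subtype.ext ha
        have h2 : y = ⟨x'.1, hXL _ x'.2⟩ := Subtype.ext hy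
        subst h1 h2
        exact hay
      · exact fun h => ⟨_, _, rfl, rfl, h⟩
    -- the relation `(i, j) ↦ crossing clusters of the annuli i and j are joined outside the inner balls`
    have hrel : (fun i j => ∃ x x' : BoxV 3 L, Crs n δ c r b s L ω i x ∧ Crs n δ c r b s L ω j x' ∧
        RO L ω (Out n δ b s L) x x') =
        fun i j => ∃ x x' : ↥X, CrsQ ρ i x ∧ CrsQ ρ j x' ∧ ρ (Sum.inr (Sum.inr (x, x'))) := by
      funext i j
      apply propext
      constructor
      · rintro ⟨x, x', hx, hx', hxx'⟩
        refine ⟨⟨x.1, hmemX hx⟩, ⟨x'.1, hmemX hx'⟩, (hcrs i x _ rfl).1 hx, (hcrs j x' _ rfl).1 hx', ?_⟩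
        rw [hpair]
        exact (hRO x x').1 hxx'
      · rintro ⟨x₀, x₀', hx₀, hx₀', hxx'⟩
        refine ⟨⟨x₀.1, hXL _ x₀.2⟩, ⟨x₀'.1, hXL _ x₀'.2⟩, (hcrs i _ x₀ rfl).2 hx₀,
          (hcrs j _ x₀' rfl).2 hx₀', ?_⟩
        rw [hpair] at hxx'
        exact (hRO _ _).2 hxx'
    simp only [hqR, Set.mem_setOf_eq, Uni, Patt, Ev, CROSS, Fin.append_left, Fin.append_right]
    rw [hrel]
    refine and_congr ⟨fun h j x x' hx hx' => ?_, fun h j x₀ x₀' hx₀ hx₀' => ?_⟩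
      (and_congr Iff.rfl (forall_congr' fun j => ?_))
    · -- from the answers to `Uni`: the crossing sites `x, x'` are rim sites, i.e. in `X`
      have := h j ⟨x.1, hmemX hx⟩ ⟨x'.1, hmemX hx'⟩ ((hcrs j x _ rfl).1 hx) ((hcrs j x' _ rfl).1 hx')
      rw [hpair] at this
      exact (hRO x x').2 this
    · -- from `Uni` to the answers
      rw [hpair]
      exact (hRO _ _).1 (h j _ _ ((hcrs j _ x₀ rfl).2 hx₀) ((hcrs j _ x₀' rfl).2 hx₀'))
    · simp only [hρ, hqA, hqB, hqO, Sum.elim_inl, thin_univ]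
  show (μ L).real _ = (μ L).real _
  congr 1
  ext ω
  simp only [Set.mem_inter_iff, Set.mem_setOf_eq]
  rw [and_assoc]
  exact key ω

end Summit.CriticalPhenomena.Ising3DConformalLimit.Theorems.EvenPatternDecoupling
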